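import Literature.Analysis.SpecialFunctions.OblateSphereResolvent
import Literature.Analysis.OperatorTheory.BandedEigenvectorRegularity
import HarnessLib

/-!
# Smoothness of the oblate spheroidal harmonics, I: decay of their spherical-harmonic
# coefficients to all orders

Dafermos–Rodnianski–Shlapentokh-Rothman, arXiv:1402.7034, §5.2.1 ("smooth eigenfunctions
`S_{mℓ}(ν, cos θ) e^{imφ}`"). In the tree the oblate spheroidal harmonics `Ψ_q(ν)` are produced as
a Hilbert eigenbasis of `L²` from the weak eigen-equation (`oblateSphere_weak`); their regularity is
recovered here quantitatively, in the Sobolev scale of `-Δ_{S²}`: with `Y_{m,k}` the spherical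
harmonic tensors (`sphHarmBasis`, levels `Λ_{m,k} = (k+|m|)(k+|m|+1)`),

  `Σ_{m,k} (1 + Λ_{m,k})^{2s} |⟨Y_{m,k}, Ψ_q(ν)⟩|² ≤ (2((1+|λ_q(ν)|)² + 25 ν⁴ 7^{2s}))^s`

for every `s ∈ ℕ` (`oblateSphereBasis_coeff_decay`). Mechanism (`BandedEigenvectorRegularity`):
the perturbation `-ν² cos²θ` is **2-banded** in the `Y_{m,k}`
(`inner_sphHarmBasis_mulSqFst_eq_zero`:
`x²` raises the polynomial degree by `2` and is symmetric; different `m` are orthogonal), the band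
has width `≤ 5` and the weights `1 + Λ` are comparable along it (factor `7`).

## References

* M. Dafermos, I. Rodnianski, Y. Shlapentokh-Rothman, arXiv:1402.7034, §5.2.1.
  [DafermosRodnianskiShlapentokhrothman2014]
* M. Reed, B. Simon, *Methods of Modern Mathematical Physics IV* (1978), §XIII.16.
  [ReedSimonIV1978]
-/

noncomputable section

open Filter Topology Set MeasureTheory ContinuousLinearMap Polynomial
open scoped InnerProductSpace ComplexConjugate ENNReal

namespace Literature.Analysis.SpecialFunctions

open Literature.Analysis.OperatorTheory Literature.Analysis.FunctionSpaces

variable {T : ℝ} [hT : Fact (0 < T)]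

/-! ### The band -/

/-- The neighbours of `(m, k)`: `(m, k')` with `|k - k'| ≤ 2` (truncated at `0`). [folklore] -/
def sphNbr (p : Σ _ : ℤ, ℕ) : Finset (Σ _ : ℤ, ℕ) :=
  (Finset.Icc (p.2 - 2) (p.2 + 2)).image fun k ↦ ⟨p.1, k⟩

/-- Membership in the band. [folklore] -/
theorem mem_sphNbr {p q : Σ _ : ℤ, ℕ} :
    q ∈ sphNbr p ↔ q.1 = p.1 ∧ p.2 - 2 ≤ q.2 ∧ q.2 ≤ p.2 + 2 := by
  rw [sphNbr, Finset.mem_image]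
  constructor
  · rintro ⟨k, hk, rfl⟩
    exact ⟨rfl, (Finset.mem_Icc.1 hk).1, (Finset.mem_Icc.1 hk).2⟩
  · rintro ⟨h1, h2, h3⟩
    refine ⟨q.2, Finset.mem_Icc.2 ⟨h2, h3⟩, ?_⟩
    obtain ⟨q1, q2⟩ := q
    simp only at h1
    subst h1
    rfl

/-- The band is symmetric. [folklore] -/
theorem sphNbr_symm (p q : Σ _ : ℤ, ℕ) : q ∈ sphNbr p ↔ p ∈ sphNbr q := by
  rw [mem_sphNbr, mem_sphNbr]
  omega

/-- The band has width `≤ 5`. [folklore] -/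
theorem card_sphNbr_le (p : Σ _ : ℤ, ℕ) : (sphNbr p).card ≤ 5 := by
  rw [sphNbr]
  refine Finset.card_image_le.trans ?_
  rw [Nat.card_Icc]
  omega

/-! ### Bandedness of `cos²θ` in the spherical harmonics -/

/-- In one sector: `⟨ẽ^m_k, x² ẽ^m_j⟩ = 0` if `j + 2 < k`. [folklore] -/
theorem inner_assocLegBasis_mulSq_eq_zero_of_lt (m : ℕ) {k j : ℕ} (h : j + 2 < k) :
    ⟪assocLegBasis m k, mulSq (assocLegBasis m j)⟫_ℂ = 0 := by
  rw [assocLegBasis_apply m j, map_smul, inner_smul_right, mulSq_assocLegL2,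
    inner_assocLegBasis_assocLegL2]
  have hdeg : (X ^ 2 * assocLegPoly m j).natDegree < k := by
    calc (X ^ 2 * assocLegPoly m j).natDegree
        ≤ (X ^ 2 : ℝ[X]).natDegree + (assocLegPoly m j).natDegree := natDegree_mul_le
      _ ≤ 2 + j := by rw [natDegree_assocLegPoly]; exact add_le_add (natDegree_X_pow_le 2) le_rfl
      _ < k := by omega
  rw [assocLegForm_assocLegPoly_of_natDegree_lt m hdeg, mul_zero, Complex.ofReal_zero, mul_zero]

/-- In one sector: `⟨ẽ^m_k, x² ẽ^m_j⟩ = 0` if `|k - j| > 2`. [folklore] -/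
theorem inner_assocLegBasis_mulSq_eq_zero (m : ℕ) {k j : ℕ} (h : j + 2 < k ∨ k + 2 < j) :
    ⟪assocLegBasis m k, mulSq (assocLegBasis m j)⟫_ℂ = 0 := by
  rcases h with h | h
  · exact inner_assocLegBasis_mulSq_eq_zero_of_lt m h
  · have hs := (ContinuousLinearMap.isSelfAdjoint_iff_isSymmetric.1 isSelfAdjoint_mulSq)
      (assocLegBasis m k) (assocLegBasis m j)
    change ⟪mulSq (assocLegBasis m k), assocLegBasis m j⟫_ℂ =
      ⟪assocLegBasis m k, mulSq (assocLegBasis m j)⟫_ℂ at hs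
    rw [← hs, ← inner_conj_symm, inner_assocLegBasis_mulSq_eq_zero_of_lt m h, map_zero]

/-- **`cos²θ` is 2-banded in the `Y_{m,k}`**: `⟨Y_q, x² Y_p⟩ = 0` off the band.
[cite: DafermosRodnianskiShlapentokhrothman2014, §5.2.1] -/
theorem inner_sphHarmBasis_mulSqFst_eq_zero {p q : Σ _ : ℤ, ℕ} (h : q ∉ sphNbr p) :
    ⟪sphHarmBasis T q, mulSqFst T (sphHarmBasis T p)⟫_ℂ = 0 := by
  rw [sphHarmBasis_apply, sphHarmBasis_apply, sphHarmTensor, sphHarmTensor, mulSqFst_tensorLp,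
    inner_tensorLp_tensorLp, inner_fourierLp_fourierLp]
  by_cases hm : q.1 = p.1
  · rw [if_pos hm, mul_one, hm]
    rw [mem_sphNbr] at h
    refine inner_assocLegBasis_mulSq_eq_zero _ ?_
    omega
  · rw [if_neg hm, mul_zero]

/-! ### The weights -/

/-- The weights `1 + Λ_{m,k}`. [folklore] -/
def sphWeight (p : Σ _ : ℤ, ℕ) : ℝ := 1 + sphLevel p

/-- `sphWeight = 1 + |level|`. [folklore] -/
theorem sphWeight_eq (p : Σ _ : ℤ, ℕ) : sphWeight p = 1 + |sphLevel p| := by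
  rw [sphWeight, abs_of_nonneg (sphLevel_nonneg p)]

/-- **Comparability of the weights along the band** (factor `7`). [folklore] -/
theorem sphWeight_le_of_mem {p q : Σ _ : ℤ, ℕ} (h : q ∈ sphNbr p) :
    sphWeight p ≤ 7 * sphWeight q := by
  rw [mem_sphNbr] at h
  obtain ⟨h1, h2, h3⟩ := h
  rw [sphWeight, sphWeight, sphLevel, sphLevel, assocLegLevel, assocLegLevel, h1]
  have hk : (p.2 : ℝ) ≤ q.2 + 2 := by exact_mod_cast (by omega : p.2 ≤ q.2 + 2)
  have hm0 : (0 : ℝ) ≤ (p.1.natAbs : ℝ) := Nat.cast_nonneg _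
  have hq0 : (0 : ℝ) ≤ (q.2 : ℝ) := Nat.cast_nonneg _
  have hp0 : (0 : ℝ) ≤ (p.2 : ℝ) := Nat.cast_nonneg _
  nlinarith [mul_le_mul hk hk hp0 (by linarith), mul_nonneg hm0 hq0]

/-! ### The decay of the coefficients -/

/-- **Decay to all orders of the spherical-harmonic coefficients of `Ψ_q(ν)`**:
`Σ_{m,k} (1+Λ_{m,k})^{2s} |⟨Y_{m,k}, Ψ_q(ν)⟩|² ≤ (2((1+|λ_q(ν)|)² + 25 ν⁴ 7^{2s}))^s`, `s ∈ ℕ`.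
[cite: DafermosRodnianskiShlapentokhrothman2014, §5.2.1] -/
theorem oblateSphereBasis_coeff_decay (ν : ℝ) (q : OblateSphereIndex ν) (s : ℕ) :
    Summable (fun p : Σ _ : ℤ, ℕ ↦
        sphWeight p ^ (2 * s) * ‖⟪sphHarmBasis T p, oblateSphereBasis T ν q⟫_ℂ‖ ^ 2) ∧
      ∑' p : Σ _ : ℤ, ℕ,
          sphWeight p ^ (2 * s) * ‖⟪sphHarmBasis T p, oblateSphereBasis T ν q⟫_ℂ‖ ^ 2 ≤
        (2 * ((1 + |oblateSphereEig ν q|) ^ 2 + 25 * (ν ^ 2) ^ 2 * 7 ^ (2 * s))) ^ s := by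
  -- the data of the abstract bootstrap
  set B : Lp ℂ 2 (sphereMeasure T) →L[ℂ] Lp ℂ 2 (sphereMeasure T) := oblatePert T ν with hBdef
  have hB0 : ∀ i j, j ∉ sphNbr i → ⟪sphHarmBasis T j, B (sphHarmBasis T i)⟫_ℂ = 0 := by
    intro i j hj
    rw [hBdef, oblatePert_apply, inner_smul_right, inner_sphHarmBasis_mulSqFst_eq_zero hj, mul_zero]
  have hBs : ∀ x y, ⟪B x, y⟫_ℂ = ⟪x, B y⟫_ℂ := fun x y ↦ by
    rw [hBdef, oblatePert_apply, oblatePert_apply, inner_smul_left, inner_smul_right,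
      inner_mulSqFst_comm]
    congr 1
    rw [map_neg, Complex.conj_ofReal]
  have hw : ∀ p, sphWeight p = 1 + |sphLevel p| := sphWeight_eq
  have heig : ∀ p, (sphLevel p : ℂ) * ⟪sphHarmBasis T p, oblateSphereBasis T ν q⟫_ℂ +
      ⟪sphHarmBasis T p, B (oblateSphereBasis T ν q)⟫_ℂ =
      (oblateSphereEig ν q : ℂ) * ⟪sphHarmBasis T p, oblateSphereBasis T ν q⟫_ℂ := by
    intro p
    rw [hBdef, oblatePert_apply, inner_smul_right, sphHarmBasis_apply]
    have h := oblateSphere_weak (T := T) ν q p.1 p.2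
    rw [sphLevel]
    linear_combination h
  have h := summable_weighted_of_eigen (e := sphHarmBasis T) (w := sphWeight) (d := sphLevel)
    (lam := oblateSphereEig ν q) (f := oblateSphereBasis T ν q) hB0 hBs sphNbr_symm
    card_sphNbr_le hw (L := 7) (by norm_num) (fun i j hj ↦ sphWeight_le_of_mem hj) heig s
  refine ⟨h.1, h.2.trans ?_⟩
  have hnorm : ‖oblateSphereBasis T ν q‖ = 1 := (oblateSphereBasis T ν).orthonormal.1 q
  rw [hnorm, one_pow, mul_one]
  have hB : ‖B‖ ≤ ν ^ 2 := norm_oblatePert_le ν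
  have hB' : ‖B‖ ^ 2 ≤ (ν ^ 2) ^ 2 := pow_le_pow_left₀ (norm_nonneg _) hB 2
  refine pow_le_pow_left₀ (by positivity) ?_ s
  have h7 : (0 : ℝ) ≤ 7 ^ (2 * s) := pow_nonneg (by norm_num) _
  have hkey : ((5 : ℕ) : ℝ) ^ 2 * ‖B‖ ^ 2 * 7 ^ (2 * s) ≤ 25 * (ν ^ 2) ^ 2 * 7 ^ (2 * s) := by
    rw [show ((5 : ℕ) : ℝ) ^ 2 = 25 by norm_num]
    exact mul_le_mul_of_nonneg_right (mul_le_mul_of_nonneg_left hB' (by norm_num)) h7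
  linarith

end Literature.Analysis.SpecialFunctions
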